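import Mathlib.LinearAlgebra.BilinearForm.Orthogonal
import Literature.AlgebraicGeometry.HodgeTheory.LocallyTrivialExtensionClasses
import Summits.HodgeConjecture.HodgeConjecture.Theorems.LinearSystemTorelliLocalTubeSpanPairs

/-!
# Route LinearSystemTorelli — crux `LocalTubeSpan` (stmt-HodgeConjecture-2490): pairs, dually

Helper file (`--supports stmt-HodgeConjecture-2490`, line `Sketch`, stub `stub_pairsDual`): the
dictionary, at the level of `H¹`, between the two phrasings of the crux ("local Schnell theorem",
C. Schnell, *Primitive cohomology and the tube mapping*, Math. Z. 268 (2010) = arXiv:0711.3927,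
§3):

* Schnell's *third map* `evalCoinv A : H¹(G, A) → ∏_{g ∈ G} A/(g - 1)A`, `[φ] ↦ (φ g)_g`
  (`Literature.AlgebraicGeometry.HodgeTheory.evalCoinv`, computation rule `evalCoinv_H1π`) kills a
  class `[φ]` iff `φ g ∈ (g - 1)A` for every `g` (`localTubeSpan_evalCoinv_H1π_eq_zero_iff`:
  `funext` and `Submodule.Quotient.mk_eq_zero`);
* when `G` acts by isometries of a nondegenerate reflexive (e.g. symmetric or skew) bilinear form
  `B` on the finite-dimensional `A` — the intersection form on the vanishing cohomology —
  `(g - 1)A = (A^g)^⊥` (`localTubeSpan_exists_sub_eq_iff` of the Pairs file), so this happens iff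
  ALL TUBE PERIODS over the local pairs vanish: `B α (φ g) = 0` for every `g` and every
  `g`-invariant `α` (`localTubeSpan_evalCoinv_eq_zero_iff_pairs`, the registered stub; and its
  version `localTubeSpan_evalCoinvOn_eq_zero_iff_pairs` for the third map `evalCoinvOn A S` on a
  subgroup `S ≤ G`, the shape in which the local fundamental group `G_{s₀} ≤ G` enters the crux).

Dually ([Schnell2010] §3 (tube-dual), §8 Lemma 13): the tube classes `τ_g(α)` over the pairs
`(g, α)`, `g α = α`, span the dual of the image of `H¹` exactly when the third map is injective.

Pure algebra over a field (Mathlib's group cohomology and bilinear forms, the tree's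
`LocallyTrivialExtensionClasses`, the Pairs file); no named facts.

References: [Schnell2010] C. Schnell, Primitive cohomology and the tube mapping, Math. Z. 268
(2010), §3 (the third map, (tube-dual)), §8 Lemma 13.
-/

-- `Summit.HodgeConjecture.HodgeConjecture.Theorems` is the mandated namespace (single-conjunct summit:
-- Sub = Summit), which `linter.dupNamespace` flags on every declaration; the lakefile turns the
-- linter off tree-wide (weak option), restated here so stand-alone elaboration is warning-free too.
set_option linter.dupNamespace false

noncomputable section

open CategoryTheory groupCohomology
open Literature.AlgebraicGeometry.HodgeTheory

namespace Summit.HodgeConjecture.HodgeConjecture.Theorems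

universe u

/-! ### The kernel of the third map, cocycle-wise -/

/-- The `g`-component of Schnell's third map vanishes on `[φ]` iff `φ g ∈ (g - 1)A`
(`evalCoinv_H1π` and `Submodule.Quotient.mk_eq_zero`).
[cite: Schnell2010, §3 (the third map, eq. (restr-M))] -/
theorem localTubeSpan_evalCoinv_H1π_apply_eq_zero_iff {k G : Type u} [CommRing k] [Group G]
    (A : Rep k G) (φ : cocycles₁ A) (g : G) :
    evalCoinv A (H1π A φ) g = 0 ↔ (φ : G → A.V) g ∈ subOneRange A g := by
  rw [evalCoinv_H1π, Submodule.mkQ_apply, Submodule.Quotient.mk_eq_zero]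

/-- Schnell's third map kills `[φ]` iff `φ g ∈ (g - 1)A` for every `g ∈ G` (the class is detected
by no single element). [cite: Schnell2010, §3 (the third map, eq. (restr-M))] -/
theorem localTubeSpan_evalCoinv_H1π_eq_zero_iff {k G : Type u} [CommRing k] [Group G]
    (A : Rep k G) (φ : cocycles₁ A) :
    evalCoinv A (H1π A φ) = 0 ↔ ∀ g : G, (φ : G → A.V) g ∈ subOneRange A g := by
  rw [funext_iff]
  exact forall_congr' fun g => localTubeSpan_evalCoinv_H1π_apply_eq_zero_iff A φ g

/-- Schnell's third map on a subgroup `S` kills `[φ]` iff `φ g ∈ (g - 1)A` for every `g ∈ S`.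
[cite: Schnell2010, §3 (the third map, eq. (restr-M))] -/
theorem localTubeSpan_evalCoinvOn_H1π_eq_zero_iff {k G : Type u} [CommRing k] [Group G]
    (A : Rep k G) (S : Subgroup G) (φ : cocycles₁ A) :
    evalCoinvOn A S (H1π A φ) = 0 ↔ ∀ g ∈ S, (φ : G → A.V) g ∈ subOneRange A g := by
  rw [funext_iff, Subtype.forall]
  refine forall₂_congr fun g _ => ?_
  rw [Pi.zero_apply, evalCoinvOn_H1π, Submodule.mkQ_apply, Submodule.Quotient.mk_eq_zero]

/-! ### The kernel of the third map in terms of pairs -/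

/-- For `G` acting by isometries of a nondegenerate reflexive bilinear form `B` on the
finite-dimensional `A`: `φ g ∈ (g - 1)A` iff `B α (φ g) = 0` for every `g`-invariant `α`
(`(g - 1)A = (A^g)^⊥`, `localTubeSpan_exists_sub_eq_iff`).
[cite: Schnell2010, §3 (tube-dual) and §8 Lemma 13] -/
theorem localTubeSpan_mem_subOneRange_iff_pairs {k G : Type u} [Field k] [Group G]
    (A : Rep.{u} k G) [FiniteDimensional k A.V] (B : LinearMap.BilinForm k A.V)
    (hB : B.Nondegenerate) (hBr : B.IsRefl) (g : G)
    (hiso : ∀ x y : A.V, B (A.ρ g x) (A.ρ g y) = B x y) (w : A.V) :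
    w ∈ subOneRange A g ↔ ∀ α : A.V, A.ρ g α = α → B α w = 0 := by
  rw [← localTubeSpan_exists_sub_eq_iff B hB hBr (A.ρ g) hiso w]
  simp only [subOneRange, LinearMap.mem_range, LinearMap.sub_apply, LinearMap.id_apply]

/-- **The kernel of Schnell's third map in terms of pairs** (stub `stub_pairsDual` of line
`Sketch`).  Let `G` act on the finite-dimensional `A` by isometries of a nondegenerate reflexive
(e.g. symmetric or skew-symmetric) bilinear form `B` — the local monodromy acting on the vanishing
cohomology with its intersection form.  Then the third map `H¹(G, A) → ∏_g A/(g - 1)A` kills the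
class of a cocycle `φ` iff ALL ITS TUBE PERIODS over local pairs vanish: `B α (φ g) = 0` for every
`g ∈ G` and every `α` with `g α = α` (the period of `ω` over the tube class `τ_g(α)` being
`⟨α, φ_ω(g)⟩`, [Schnell2010] §3 (tube-dual), §8 Lemma 13).  Hence the third map is injective iff
the only classes with all pair periods zero are the trivial ones — the two phrasings of the crux
agree. [cite: Schnell2010, §3 (tube-dual) and §8 Lemma 13] -/
theorem localTubeSpan_evalCoinv_eq_zero_iff_pairs {k G : Type u} [Field k] [Group G] (A : Rep k G)
    [FiniteDimensional k A.V] (B : LinearMap.BilinForm k A.V)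
    (hB : B.Nondegenerate) (hBr : B.IsRefl)
    (hiso : ∀ (g : G) (x y : A.V), B (A.ρ g x) (A.ρ g y) = B x y) (φ : cocycles₁ A) :
    evalCoinv A (H1π A φ) = 0 ↔
      ∀ (g : G) (α : A.V), A.ρ g α = α → B α ((φ : G → A.V) g) = 0 := by
  rw [localTubeSpan_evalCoinv_H1π_eq_zero_iff]
  exact forall_congr' fun g =>
    localTubeSpan_mem_subOneRange_iff_pairs A B hB hBr g (hiso g) ((φ : G → A.V) g)

/-- **The kernel of Schnell's third map on a subgroup in terms of pairs**: for `G` acting by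
isometries of a nondegenerate reflexive form on the finite-dimensional `A` and a subgroup `S ≤ G`
(a local fundamental group `G_{s₀}`), `evalCoinvOn A S [φ] = 0` iff `B α (φ g) = 0` for every
`g ∈ S` and every `g`-invariant `α` — all tube periods over the LOCAL pairs vanish.
[cite: Schnell2010, §3 (tube-dual) and §8 Lemma 13] -/
theorem localTubeSpan_evalCoinvOn_eq_zero_iff_pairs {k G : Type u} [Field k] [Group G]
    (A : Rep k G) [FiniteDimensional k A.V] (B : LinearMap.BilinForm k A.V)
    (hB : B.Nondegenerate) (hBr : B.IsRefl)
    (hiso : ∀ (g : G) (x y : A.V), B (A.ρ g x) (A.ρ g y) = B x y) (S : Subgroup G)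
    (φ : cocycles₁ A) :
    evalCoinvOn A S (H1π A φ) = 0 ↔
      ∀ g ∈ S, ∀ α : A.V, A.ρ g α = α → B α ((φ : G → A.V) g) = 0 := by
  rw [localTubeSpan_evalCoinvOn_H1π_eq_zero_iff]
  exact forall₂_congr fun g _ =>
    localTubeSpan_mem_subOneRange_iff_pairs A B hB hBr g (hiso g) ((φ : G → A.V) g)

end Summit.HodgeConjecture.HodgeConjecture.Theorems

end
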